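import Literature.Geometry.Lorentzian.KerrPrincipalFrameCurvatureTable
import Literature.Geometry.Lorentzian.KerrPrincipalFrameBasis
import Literature.Geometry.Lorentzian.KerrCurvatureInvariantsTransport

/-!
# Fact F4 of the line `crush-the-swallowed-interior`: the cubic curvature invariant of Kerr

Support for the crux `PhotonSphereChannels.TameCensorship` (item stmt-FinalStateConjecture-10047),
stub `stub_factKerrCubicWeyl` of the lead's skeleton (hypothesis `hT` of `stub_phaseRigidity`): for
ALL real `M, a`, every point `x` of the ingoing Kerr–Schild Cartesian chart with
`r = Kerr.radius a x > 0` and EVERY linear frame `b` of `E4`,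

  `Σ g^{ii'} g^{jj'} g^{kk'} tr(R(b_i,b_j) ∘ R(b_{j'},b_k) ∘ R(b_{k'},b_{i'}))
      = 48 M³ Re (r + i a cos θ)⁹ / (r² + a² cos²θ)⁹`,   `cos θ = x₃ / r`,

the full contraction `R^{ab}{}_{cd} R^{cd}{}_{ef} R^{ef}{}_{ab}` of the curvature of the
Kerr–Schild components `Kerr.bilin M a` (`MetricCoord.riemAt/ginv/traceCLM`, `CoordCurvature.lean`).
Kerr being Ricci-flat of Petrov type D with `Ψ₂ = −M/(r − ia cos θ)³` (Kinnersley 1969;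
Chandrasekhar 1983, §58), the invariant is generated by `Ψ₂` alone: Cherubini–Bini–Capozziello–
Ruffini, Int. J. Mod. Phys. D 11 (2002) 827, §4; Abdelqader–Lake, Phys. Rev. D 91 (2015) 084017
(arXiv:1412.8757), §III.

## Proof

In ingoing Kerr coordinates `u = (t*, r, μ, φ)` the rational principal frame `𝔣 = (l, n, e₃, e₄)`
(`KerrPrincipalFrameBasis.lean`) block-diagonalises the curvature: the full lowered tables
`g(R(f_i,f_j) f_q, f_k)` (`KerrPrincipalFrameCurvatureTable.lean`, collected in `pf_low4`) raised
through the inverse Gram matrix (`basis_action_of_lowered`, `Kerr.Ingoing.pf_sum_ginv`) give the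
action of every `R(f_i,f_j)` on the frame by a sparse matrix with entries `±cA/Σ², ±cB/Σ²`
(`A + iB = M(r + iaμ)³`), so the 64 triple traces are explicit
(`MetricCoord.traceCLM_comp₃_eq_sum_of_basis_action`) and the three metric contractions collapse to
the rational identity `48(A³ − 3AB²)/Σ⁹ = 48 M³ Re(r + iaμ)⁹/Σ⁹` (`cubicTrace_frame`). The
contraction does not depend on the frame (`MetricCoord.cubicTrace_eq_of_basis`): this is the
coordinate-basis closed form `cubicTrace_ingoing`, which `Kerr.cubicTrace_kerrBilin_of_ingoing`
(`KerrCurvatureInvariantsTransport.lean`: naturality along the chart `Kerr.Ingoing.chartFun`,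
continuity across the rotation axis `Kerr.eqOn_region_of_offAxis`) transports to the Kerr–Schild
chart in every basis.
-/

noncomputable section

set_option maxSynthPendingDepth 3

namespace
  Summit.FinalStateConjecture.FinalStateConjecture.Theorems.PhotonSphereChannels.TameCensorshipCrush

open Literature.Geometry.Lorentzian Literature.Geometry.Lorentzian.Kerr.Ingoing
open Literature.Geometry.Lorentzian.MetricCoord
open scoped Manifold ContDiff Topology
open Set Module

/-! ### Linear algebra: the action of an endomorphism on a basis from its lowered table -/

section Generic

variable {E : Type*} [NormedAddCommGroup E] [NormedSpace ℝ E] [FiniteDimensional ℝ E]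
  {ι : Type*} [Fintype ι] (b : Module.Basis ι ℝ E) {G : E → E →L[ℝ] E →L[ℝ] ℝ} {x : E}

/-- **An endomorphism acts on a basis through its lowered table raised by `g⁻¹`**: if
`G(T b_q, b_k) = L[k,q]` for all `k, q` and `G x` is nondegenerate, then
`T b_q = Σ_p (Σ_s g^{ps} L[s,q]) b_p` (`bᵖ(v) = Σ_s g^{ps} G(v, b_s)`, O'Neill 1983, Ch. 3, p. 60;
`MetricCoord.coord_eq_sum_ginv`). -/
theorem basis_action_of_lowered (hx : (G x).IsInvertible) {T : E →L[ℝ] E} {L : ι → ι → ℝ}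
    (h : ∀ k q, G x (T (b q)) (b k) = L k q) (q : ι) :
    T (b q) = ∑ p, (∑ s, ginv G b x p s * L s q) • b p := by
  conv_lhs => rw [← b.sum_repr (T (b q))]
  refine Finset.sum_congr rfl fun p _ ↦ ?_
  rw [← b.coord_apply, coord_eq_sum_ginv b hx]
  simp only [h]

end Generic

/-! ### The cubic invariant of the rational Kerr components in the principal frame -/

section Ingoing

variable (M a : ℝ) {u : E4}

/-- **All lowered frame components of the Kerr curvature tensor in one table**:
`g(R(f_i,f_j) f_q, f_k)` for all ordered pairs `(i, j)` of the principal frame `𝔣 = (l, n, e₃, e₄)`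
and all `k, q` (blocks `(i, j)`; `R(f_j,f_i) = −R(f_i,f_j)`, `R(f_i,f_i) = 0`), from the six tables
`Kerr.Ingoing.pf_low_*` (`KerrPrincipalFrameCurvatureTable.lean`): the Petrov type D pattern of
Kerr, generated by `A + iB = M(r + iaμ)³` alone (Kinnersley 1969; Chandrasekhar 1983, §58). -/
theorem pf_low4 (hu : u ∈ regularSet a) (𝔣 : Fin 4 → E4)
    (h𝔣 : ∀ i, 𝔣 i =
      ![(!₂[u 1 ^ 2 + 2 * M * u 1 + a ^ 2, u 1 ^ 2 - 2 * M * u 1 + a ^ 2, (0 : ℝ), 2 * a] : E4),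
        (!₂[(1 : ℝ), -1, 0, 0] : E4), (!₂[(0 : ℝ), 0, 1 - u 2 ^ 2, 0] : E4),
        (!₂[a * (1 - u 2 ^ 2), (0 : ℝ), 0, 1] : E4)] i) (i j k q : Fin 4) :
    bilin M a u (riemAt (bilin M a) u (𝔣 i) (𝔣 j) (𝔣 q)) (𝔣 k) =
      (![![(0 : Matrix (Fin 4) (Fin 4) ℝ),
        (!![0, -(8 * M * (u 1 ^ (3 : ℕ) - 3 * u 1 * a ^ (2 : ℕ) * u 2 ^ (2 : ℕ))) / sigma a u, 0, 0;
            8 * M * (u 1 ^ (3 : ℕ) - 3 * u 1 * a ^ (2 : ℕ) * u 2 ^ (2 : ℕ)) / sigma a u, 0, 0, 0;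
            0, 0, 0,
              4 * M * (3 * u 1 ^ (2 : ℕ) * a * u 2 - a ^ (3 : ℕ) * u 2 ^ (3 : ℕ)) * (1 - u 2 ^ (2 : ℕ)) / sigma a u;
            0, 0,
              -(4 * M * (3 * u 1 ^ (2 : ℕ) * a * u 2 - a ^ (3 : ℕ) * u 2 ^ (3 : ℕ)) * (1 - u 2 ^ (2 : ℕ))) / sigma a u,
              0] : Matrix (Fin 4) (Fin 4) ℝ),
        (!![0, 0, 0, 0;
            0, 0,
              2 * M * (u 1 ^ (3 : ℕ) - 3 * u 1 * a ^ (2 : ℕ) * u 2 ^ (2 : ℕ)) * (1 - u 2 ^ (2 : ℕ)) / sigma a u,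
              2 * M * (3 * u 1 ^ (2 : ℕ) * a * u 2 - a ^ (3 : ℕ) * u 2 ^ (3 : ℕ)) * (1 - u 2 ^ (2 : ℕ)) / sigma a u;
            0,
              -(2 * M * (u 1 ^ (3 : ℕ) - 3 * u 1 * a ^ (2 : ℕ) * u 2 ^ (2 : ℕ)) * (1 - u 2 ^ (2 : ℕ))) / sigma a u,
              0, 0;
            0,
              -(2 * M * (3 * u 1 ^ (2 : ℕ) * a * u 2 - a ^ (3 : ℕ) * u 2 ^ (3 : ℕ)) * (1 - u 2 ^ (2 : ℕ))) / sigma a u,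
              0, 0] : Matrix (Fin 4) (Fin 4) ℝ),
        (!![0, 0, 0, 0;
            0, 0,
              -(2 * M * (3 * u 1 ^ (2 : ℕ) * a * u 2 - a ^ (3 : ℕ) * u 2 ^ (3 : ℕ)) * (1 - u 2 ^ (2 : ℕ))) / sigma a u,
              2 * M * (u 1 ^ (3 : ℕ) - 3 * u 1 * a ^ (2 : ℕ) * u 2 ^ (2 : ℕ)) * (1 - u 2 ^ (2 : ℕ)) / sigma a u;
            0,
              2 * M * (3 * u 1 ^ (2 : ℕ) * a * u 2 - a ^ (3 : ℕ) * u 2 ^ (3 : ℕ)) * (1 - u 2 ^ (2 : ℕ)) / sigma a u,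
              0, 0;
            0,
              -(2 * M * (u 1 ^ (3 : ℕ) - 3 * u 1 * a ^ (2 : ℕ) * u 2 ^ (2 : ℕ)) * (1 - u 2 ^ (2 : ℕ))) / sigma a u,
              0, 0] : Matrix (Fin 4) (Fin 4) ℝ)],
      ![-(!![0, -(8 * M * (u 1 ^ (3 : ℕ) - 3 * u 1 * a ^ (2 : ℕ) * u 2 ^ (2 : ℕ))) / sigma a u, 0, 0;
            8 * M * (u 1 ^ (3 : ℕ) - 3 * u 1 * a ^ (2 : ℕ) * u 2 ^ (2 : ℕ)) / sigma a u, 0, 0, 0;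
            0, 0, 0,
              4 * M * (3 * u 1 ^ (2 : ℕ) * a * u 2 - a ^ (3 : ℕ) * u 2 ^ (3 : ℕ)) * (1 - u 2 ^ (2 : ℕ)) / sigma a u;
            0, 0,
              -(4 * M * (3 * u 1 ^ (2 : ℕ) * a * u 2 - a ^ (3 : ℕ) * u 2 ^ (3 : ℕ)) * (1 - u 2 ^ (2 : ℕ))) / sigma a u,
              0] : Matrix (Fin 4) (Fin 4) ℝ),
        (0 : Matrix (Fin 4) (Fin 4) ℝ),
        (!![0, 0,
              2 * M * (u 1 ^ (3 : ℕ) - 3 * u 1 * a ^ (2 : ℕ) * u 2 ^ (2 : ℕ)) * (1 - u 2 ^ (2 : ℕ)) / sigma a u,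
              -(2 * M * (3 * u 1 ^ (2 : ℕ) * a * u 2 - a ^ (3 : ℕ) * u 2 ^ (3 : ℕ)) * (1 - u 2 ^ (2 : ℕ))) / sigma a u;
            0, 0, 0, 0;
            -(2 * M * (u 1 ^ (3 : ℕ) - 3 * u 1 * a ^ (2 : ℕ) * u 2 ^ (2 : ℕ)) * (1 - u 2 ^ (2 : ℕ))) / sigma a u,
              0, 0, 0;
            2 * M * (3 * u 1 ^ (2 : ℕ) * a * u 2 - a ^ (3 : ℕ) * u 2 ^ (3 : ℕ)) * (1 - u 2 ^ (2 : ℕ)) / sigma a u,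
              0, 0, 0] : Matrix (Fin 4) (Fin 4) ℝ),
        (!![0, 0,
              2 * M * (3 * u 1 ^ (2 : ℕ) * a * u 2 - a ^ (3 : ℕ) * u 2 ^ (3 : ℕ)) * (1 - u 2 ^ (2 : ℕ)) / sigma a u,
              2 * M * (u 1 ^ (3 : ℕ) - 3 * u 1 * a ^ (2 : ℕ) * u 2 ^ (2 : ℕ)) * (1 - u 2 ^ (2 : ℕ)) / sigma a u;
            0, 0, 0, 0;
            -(2 * M * (3 * u 1 ^ (2 : ℕ) * a * u 2 - a ^ (3 : ℕ) * u 2 ^ (3 : ℕ)) * (1 - u 2 ^ (2 : ℕ))) / sigma a u,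
              0, 0, 0;
            -(2 * M * (u 1 ^ (3 : ℕ) - 3 * u 1 * a ^ (2 : ℕ) * u 2 ^ (2 : ℕ)) * (1 - u 2 ^ (2 : ℕ))) / sigma a u,
              0, 0, 0] : Matrix (Fin 4) (Fin 4) ℝ)],
      ![-(!![0, 0, 0, 0;
            0, 0,
              2 * M * (u 1 ^ (3 : ℕ) - 3 * u 1 * a ^ (2 : ℕ) * u 2 ^ (2 : ℕ)) * (1 - u 2 ^ (2 : ℕ)) / sigma a u,
              2 * M * (3 * u 1 ^ (2 : ℕ) * a * u 2 - a ^ (3 : ℕ) * u 2 ^ (3 : ℕ)) * (1 - u 2 ^ (2 : ℕ)) / sigma a u;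
            0,
              -(2 * M * (u 1 ^ (3 : ℕ) - 3 * u 1 * a ^ (2 : ℕ) * u 2 ^ (2 : ℕ)) * (1 - u 2 ^ (2 : ℕ))) / sigma a u,
              0, 0;
            0,
              -(2 * M * (3 * u 1 ^ (2 : ℕ) * a * u 2 - a ^ (3 : ℕ) * u 2 ^ (3 : ℕ)) * (1 - u 2 ^ (2 : ℕ))) / sigma a u,
              0, 0] : Matrix (Fin 4) (Fin 4) ℝ),
        -(!![0, 0,
              2 * M * (u 1 ^ (3 : ℕ) - 3 * u 1 * a ^ (2 : ℕ) * u 2 ^ (2 : ℕ)) * (1 - u 2 ^ (2 : ℕ)) / sigma a u,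
              -(2 * M * (3 * u 1 ^ (2 : ℕ) * a * u 2 - a ^ (3 : ℕ) * u 2 ^ (3 : ℕ)) * (1 - u 2 ^ (2 : ℕ))) / sigma a u;
            0, 0, 0, 0;
            -(2 * M * (u 1 ^ (3 : ℕ) - 3 * u 1 * a ^ (2 : ℕ) * u 2 ^ (2 : ℕ)) * (1 - u 2 ^ (2 : ℕ))) / sigma a u,
              0, 0, 0;
            2 * M * (3 * u 1 ^ (2 : ℕ) * a * u 2 - a ^ (3 : ℕ) * u 2 ^ (3 : ℕ)) * (1 - u 2 ^ (2 : ℕ)) / sigma a u,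
              0, 0, 0] : Matrix (Fin 4) (Fin 4) ℝ),
        (0 : Matrix (Fin 4) (Fin 4) ℝ),
        (!![0,
              4 * M * (3 * u 1 ^ (2 : ℕ) * a * u 2 - a ^ (3 : ℕ) * u 2 ^ (3 : ℕ)) * (1 - u 2 ^ (2 : ℕ)) / sigma a u,
              0, 0;
            -(4 * M * (3 * u 1 ^ (2 : ℕ) * a * u 2 - a ^ (3 : ℕ) * u 2 ^ (3 : ℕ)) * (1 - u 2 ^ (2 : ℕ))) / sigma a u,
              0, 0, 0;
            0, 0, 0,
              2 * M * (u 1 ^ (3 : ℕ) - 3 * u 1 * a ^ (2 : ℕ) * u 2 ^ (2 : ℕ)) * (1 - u 2 ^ (2 : ℕ)) ^ (2 : ℕ) / sigma a u;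
            0, 0,
              -(2 * M * (u 1 ^ (3 : ℕ) - 3 * u 1 * a ^ (2 : ℕ) * u 2 ^ (2 : ℕ)) * (1 - u 2 ^ (2 : ℕ)) ^ (2 : ℕ)) / sigma a u,
              0] : Matrix (Fin 4) (Fin 4) ℝ)],
      ![-(!![0, 0, 0, 0;
            0, 0,
              -(2 * M * (3 * u 1 ^ (2 : ℕ) * a * u 2 - a ^ (3 : ℕ) * u 2 ^ (3 : ℕ)) * (1 - u 2 ^ (2 : ℕ))) / sigma a u,
              2 * M * (u 1 ^ (3 : ℕ) - 3 * u 1 * a ^ (2 : ℕ) * u 2 ^ (2 : ℕ)) * (1 - u 2 ^ (2 : ℕ)) / sigma a u;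
            0,
              2 * M * (3 * u 1 ^ (2 : ℕ) * a * u 2 - a ^ (3 : ℕ) * u 2 ^ (3 : ℕ)) * (1 - u 2 ^ (2 : ℕ)) / sigma a u,
              0, 0;
            0,
              -(2 * M * (u 1 ^ (3 : ℕ) - 3 * u 1 * a ^ (2 : ℕ) * u 2 ^ (2 : ℕ)) * (1 - u 2 ^ (2 : ℕ))) / sigma a u,
              0, 0] : Matrix (Fin 4) (Fin 4) ℝ),
        -(!![0, 0,
              2 * M * (3 * u 1 ^ (2 : ℕ) * a * u 2 - a ^ (3 : ℕ) * u 2 ^ (3 : ℕ)) * (1 - u 2 ^ (2 : ℕ)) / sigma a u,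
              2 * M * (u 1 ^ (3 : ℕ) - 3 * u 1 * a ^ (2 : ℕ) * u 2 ^ (2 : ℕ)) * (1 - u 2 ^ (2 : ℕ)) / sigma a u;
            0, 0, 0, 0;
            -(2 * M * (3 * u 1 ^ (2 : ℕ) * a * u 2 - a ^ (3 : ℕ) * u 2 ^ (3 : ℕ)) * (1 - u 2 ^ (2 : ℕ))) / sigma a u,
              0, 0, 0;
            -(2 * M * (u 1 ^ (3 : ℕ) - 3 * u 1 * a ^ (2 : ℕ) * u 2 ^ (2 : ℕ)) * (1 - u 2 ^ (2 : ℕ))) / sigma a u,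
              0, 0, 0] : Matrix (Fin 4) (Fin 4) ℝ),
        -(!![0,
              4 * M * (3 * u 1 ^ (2 : ℕ) * a * u 2 - a ^ (3 : ℕ) * u 2 ^ (3 : ℕ)) * (1 - u 2 ^ (2 : ℕ)) / sigma a u,
              0, 0;
            -(4 * M * (3 * u 1 ^ (2 : ℕ) * a * u 2 - a ^ (3 : ℕ) * u 2 ^ (3 : ℕ)) * (1 - u 2 ^ (2 : ℕ))) / sigma a u,
              0, 0, 0;
            0, 0, 0,
              2 * M * (u 1 ^ (3 : ℕ) - 3 * u 1 * a ^ (2 : ℕ) * u 2 ^ (2 : ℕ)) * (1 - u 2 ^ (2 : ℕ)) ^ (2 : ℕ) / sigma a u;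
            0, 0,
              -(2 * M * (u 1 ^ (3 : ℕ) - 3 * u 1 * a ^ (2 : ℕ) * u 2 ^ (2 : ℕ)) * (1 - u 2 ^ (2 : ℕ)) ^ (2 : ℕ)) / sigma a u,
              0] : Matrix (Fin 4) (Fin 4) ℝ),
        (0 : Matrix (Fin 4) (Fin 4) ℝ)]] : Fin 4 → Fin 4 → Matrix (Fin 4) (Fin 4) ℝ) i j k q := by
  have h0 : 𝔣 0 = (!₂[u 1 ^ 2 + 2 * M * u 1 + a ^ 2, u 1 ^ 2 - 2 * M * u 1 + a ^ 2, (0 : ℝ), 2 * a] : E4) := by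
    rw [h𝔣]; rfl
  have h1 : 𝔣 1 = (!₂[(1 : ℝ), -1, 0, 0] : E4) := by rw [h𝔣]; rfl
  have h2 : 𝔣 2 = (!₂[(0 : ℝ), 0, 1 - u 2 ^ 2, 0] : E4) := by rw [h𝔣]; rfl
  have h3 : 𝔣 3 = (!₂[a * (1 - u 2 ^ 2), (0 : ℝ), 0, 1] : E4) := by rw [h𝔣]; rfl
  fin_cases i <;> fin_cases j <;>
    simp only [Fin.zero_eta, Fin.mk_one, Fin.reduceFinMk, Fin.isValue, Matrix.cons_val_zero,
      Matrix.cons_val_one, Matrix.cons_val]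
  · rw [riemAt_self, zero_apply, map_zero, zero_apply,
      Matrix.zero_apply]
  · exact pf_low_ln M a hu 𝔣 h0 h1 h2 h3 k q
  · exact pf_low_l3 M a hu 𝔣 h0 h1 h2 h3 k q
  · exact pf_low_l4 M a hu 𝔣 h0 h1 h2 h3 k q
  · rw [riemAt_swap, neg_apply, map_neg, neg_apply, pf_low_ln M a hu 𝔣 h0 h1 h2 h3 k q,
      Matrix.neg_apply]
  · rw [riemAt_self, zero_apply, map_zero, zero_apply,
      Matrix.zero_apply]
  · exact pf_low_n3 M a hu 𝔣 h0 h1 h2 h3 k q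
  · exact pf_low_n4 M a hu 𝔣 h0 h1 h2 h3 k q
  · rw [riemAt_swap, neg_apply, map_neg, neg_apply, pf_low_l3 M a hu 𝔣 h0 h1 h2 h3 k q,
      Matrix.neg_apply]
  · rw [riemAt_swap, neg_apply, map_neg, neg_apply, pf_low_n3 M a hu 𝔣 h0 h1 h2 h3 k q,
      Matrix.neg_apply]
  · rw [riemAt_self, zero_apply, map_zero, zero_apply,
      Matrix.zero_apply]
  · exact pf_low_34 M a hu 𝔣 h0 h1 h2 h3 k q
  · rw [riemAt_swap, neg_apply, map_neg, neg_apply, pf_low_l4 M a hu 𝔣 h0 h1 h2 h3 k q,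
      Matrix.neg_apply]
  · rw [riemAt_swap, neg_apply, map_neg, neg_apply, pf_low_n4 M a hu 𝔣 h0 h1 h2 h3 k q,
      Matrix.neg_apply]
  · rw [riemAt_swap, neg_apply, map_neg, neg_apply, pf_low_34 M a hu 𝔣 h0 h1 h2 h3 k q,
      Matrix.neg_apply]
  · rw [riemAt_self, zero_apply, map_zero, zero_apply,
      Matrix.zero_apply]

/-- `(MX)³ − 3(MX)(MY)² = M³ Re (r + iaμ)⁹` with `X + iY = (r + iaμ)³`: the real part of
`M³ (r + iaμ)⁹` as a polynomial. [folklore] -/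
theorem cubic_re_identity (M r a μ : ℝ) :
    (M * (r ^ 3 - 3 * r * a ^ 2 * μ ^ 2)) ^ 3 -
        3 * (M * (r ^ 3 - 3 * r * a ^ 2 * μ ^ 2)) * (M * (3 * r ^ 2 * a * μ - a ^ 3 * μ ^ 3)) ^ 2 =
      M ^ 3 * (r ^ 9 - 36 * r ^ 7 * (a * μ) ^ 2 + 126 * r ^ 5 * (a * μ) ^ 4 - 84 * r ^ 3 * (a * μ) ^ 6 +
        9 * r * (a * μ) ^ 8) := by
  ring

-- The next proof expands the three collapsed contractions (64 terms) and the 64 triple traces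
-- through the sparse frame actions before one rational identity; the `simp only` expansions need
-- a little more than the default budget.
set_option maxHeartbeats 400000 in
/-- **The cubic curvature invariant of Kerr in its principal frame** (ingoing Kerr coordinates,
regular set `{Σ ≠ 0, μ² ≠ 1}`): for the rational principal frame `𝔣 = (l, n, e₃, e₄)`,
`Σ g^{ii'}g^{jj'}g^{kk'} tr(R(f_i,f_j) R(f_{j'},f_k) R(f_{k'},f_{i'})) = 48 M³ Re(r + iaμ)⁹/Σ⁹`
(`= 48(A³ − 3AB²)/Σ⁹`, `A + iB = M(r + iaμ)³`; Petrov type D, Kinnersley 1969; the value of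
Cherubini–Bini–Capozziello–Ruffini 2002, §4, for all real `M, a`). -/
theorem cubicTrace_frame (hu : u ∈ regularSet a) (𝔣 : Module.Basis (Fin 4) ℝ E4)
    (h𝔣 : ∀ i, 𝔣 i =
      ![(!₂[u 1 ^ 2 + 2 * M * u 1 + a ^ 2, u 1 ^ 2 - 2 * M * u 1 + a ^ 2, (0 : ℝ), 2 * a] : E4),
        (!₂[(1 : ℝ), -1, 0, 0] : E4), (!₂[(0 : ℝ), 0, 1 - u 2 ^ 2, 0] : E4),
        (!₂[a * (1 - u 2 ^ 2), (0 : ℝ), 0, 1] : E4)] i) :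
    ∑ i, ∑ i', ∑ j, ∑ j', ∑ k, ∑ k',
        ginv (bilin M a) 𝔣 u i i' * ginv (bilin M a) 𝔣 u j j' * ginv (bilin M a) 𝔣 u k k' *
        traceCLM E4 ((riemAt (bilin M a) u (𝔣 i) (𝔣 j)).comp
          ((riemAt (bilin M a) u (𝔣 j') (𝔣 k)).comp (riemAt (bilin M a) u (𝔣 k') (𝔣 i')))) =
      48 * M ^ 3 * (u 1 ^ 9 - 36 * u 1 ^ 7 * (a * u 2) ^ 2 + 126 * u 1 ^ 5 * (a * u 2) ^ 4 -
        84 * u 1 ^ 3 * (a * u 2) ^ 6 + 9 * u 1 * (a * u 2) ^ 8) / (u 1 ^ 2 + (a * u 2) ^ 2) ^ 9 := by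
  have hS := hu.1
  have hP : (1 : ℝ) - u 2 ^ 2 ≠ 0 := hu.2
  have hlow := pf_low4 M a hu 𝔣 h𝔣
  have hact := fun i j ↦ basis_action_of_lowered 𝔣 (isInvertible_bilin M a hu) (hlow i j)
  have htr := fun i j i' j' i'' j'' ↦
    traceCLM_comp₃_eq_sum_of_basis_action 𝔣 (hact i j) (hact i' j') (hact i'' j'')
  rw [cubicTrace_eq_nested]
  -- the three metric contractions collapse in the frame (`g⁻¹` pairs `l ↔ n`, `e₃`, `e₄`)
  simp only [pf_sum_ginv M a hu 𝔣 h𝔣]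
  simp only [Fin.sum_univ_four, Fin.isValue, Matrix.cons_val_zero, Matrix.cons_val_one,
    Matrix.cons_val]
  -- the 64 triple traces through the sparse frame actions
  simp only [htr]
  simp (maxSteps := 4000000) only [Fin.isValue, Matrix.cons_val_zero, Matrix.cons_val_one,
    Matrix.cons_val, Matrix.of_apply, Matrix.neg_apply, Matrix.zero_apply, mul_zero, zero_mul,
    Finset.sum_const_zero, pf_sum_ginv M a hu 𝔣 h𝔣]
  simp (maxSteps := 4000000) only [Fin.sum_univ_four, Fin.isValue, Matrix.cons_val_zero,
    Matrix.cons_val_one, Matrix.cons_val, mul_zero, zero_mul, neg_zero, add_zero, zero_add, mul_neg,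
    neg_mul, neg_neg]
  -- the rational identity `48(A³ − 3AB²)/Σ⁹ = 48 M³ Re(r + iaμ)⁹/Σ⁹` (`A = MX`, `B = MY`)
  have hσ : u 1 ^ 2 + (a * u 2) ^ 2 = sigma a u := by rw [sigma]; ring
  conv_rhs => rw [hσ, mul_assoc, ← cubic_re_identity M (u 1) a (u 2)]
  generalize (u 1 ^ 3 - 3 * u 1 * a ^ 2 * u 2 ^ 2 : ℝ) = X
  generalize (3 * u 1 ^ 2 * a * u 2 - a ^ 3 * u 2 ^ 3 : ℝ) = Y
  simp only [sinSq]
  field_simp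
  ring

/-- **The cubic curvature invariant of Kerr in ingoing Kerr coordinates** (coordinate basis): on
the regular set, `Σ g^{ii'}g^{jj'}g^{kk'} tr(R(∂_i,∂_j) R(∂_{j'},∂_k) R(∂_{k'},∂_{i'})) =
48 M³ Re(r + iaμ)⁹/Σ⁹` for the rational components `Kerr.Ingoing.bilin M a` — verbatim the
hypothesis of `Kerr.cubicTrace_kerrBilin_of_ingoing`; from `cubicTrace_frame` by basis independence
(`MetricCoord.cubicTrace_eq_of_basis`, `Kerr.Ingoing.exists_frameBasis`). -/
theorem cubicTrace_ingoing (hu : u ∈ regularSet a) :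
    ∑ i, ∑ i', ∑ j, ∑ j', ∑ k, ∑ k',
        ginv (bilin M a) (EuclideanSpace.basisFun (Fin 4) ℝ).toBasis u i i' *
        ginv (bilin M a) (EuclideanSpace.basisFun (Fin 4) ℝ).toBasis u j j' *
        ginv (bilin M a) (EuclideanSpace.basisFun (Fin 4) ℝ).toBasis u k k' *
        traceCLM E4 ((riemAt (bilin M a) u (E4.basisVector i) (E4.basisVector j)).comp
          ((riemAt (bilin M a) u (E4.basisVector j') (E4.basisVector k)).comp
            (riemAt (bilin M a) u (E4.basisVector k') (E4.basisVector i')))) =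
      48 * M ^ 3 * (u 1 ^ 9 - 36 * u 1 ^ 7 * (a * u 2) ^ 2 + 126 * u 1 ^ 5 * (a * u 2) ^ 4 -
        84 * u 1 ^ 3 * (a * u 2) ^ 6 + 9 * u 1 * (a * u 2) ^ 8) / (u 1 ^ 2 + (a * u 2) ^ 2) ^ 9 := by
  obtain ⟨𝔣, h𝔣⟩ := exists_frameBasis M a hu
  rw [← cubicTrace_frame M a hu 𝔣 h𝔣,
    cubicTrace_eq_of_basis (bilin M a) 𝔣 (EuclideanSpace.basisFun (Fin 4) ℝ).toBasis u]
  simp only [basisFun_toBasis_apply]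

end Ingoing

/-- **FACT F4 — the cubic curvature invariant of the Kerr metric** (in the tree's conventions: the
frame-independent contraction `Σ g^{ii'}g^{jj'}g^{kk'} tr(R(b_i,b_j) R(b_{j'},b_k) R(b_{k'},b_{i'}))`
of the Kerr–Schild component field `Kerr.bilin M a`, `= R^{ab}{}_{cd}R^{cd}{}_{ef}R^{ef}{}_{ab}`):
on `{r > 0}`, in every basis `b` of `E4`, it equals `48 M³ Re (r + i a cos θ)⁹ / Σ⁹`,
`cos θ = x₃/r`, `Σ = r² + a² cos² θ`, for all real `M, a` (Petrov type D, `Ψ₂ = −M/(r − ia cos θ)³`;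
Cherubini–Bini–Capozziello–Ruffini, Int. J. Mod. Phys. D 11 (2002) 827, §4; Abdelqader–Lake,
Phys. Rev. D 91 (2015) 084017, §III). Proof: principal frame in ingoing Kerr coordinates
(`cubicTrace_ingoing`) and transport to the chart, the axis by continuity
(`Kerr.cubicTrace_kerrBilin_of_ingoing`). -/
theorem stub_factKerrCubicWeyl :
    ∀ (M a : ℝ) (x : E4), 0 < Kerr.radius a x → ∀ (b : Module.Basis (Fin 4) ℝ E4),
      ∑ i, ∑ i', ∑ j, ∑ j', ∑ k, ∑ k',
        MetricCoord.ginv (Kerr.bilin M a) b x i i' * MetricCoord.ginv (Kerr.bilin M a) b x j j' *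
        MetricCoord.ginv (Kerr.bilin M a) b x k k' *
        MetricCoord.traceCLM E4 ((MetricCoord.riemAt (Kerr.bilin M a) x (b i) (b j)).comp
          ((MetricCoord.riemAt (Kerr.bilin M a) x (b j') (b k)).comp
            (MetricCoord.riemAt (Kerr.bilin M a) x (b k') (b i')))) =
        48 * M ^ 3 * (((Kerr.radius a x : ℂ) +
          ((a * (x 3 / Kerr.radius a x) : ℝ) : ℂ) * Complex.I) ^ 9).re /
          (Kerr.radius a x ^ 2 + (a * (x 3 / Kerr.radius a x)) ^ 2) ^ 9 := by
  intro M a x hx b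
  exact Kerr.cubicTrace_kerrBilin_of_ingoing M a
    (fun u hu ↦ cubicTrace_ingoing M a (mem_regularSet_of_mem_coordDomain hu)) x hx b

end
  Summit.FinalStateConjecture.FinalStateConjecture.Theorems.PhotonSphereChannels.TameCensorshipCrush

end
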